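import Literature.Probability.LatticeModels.ThermodynamicLimit
import Mathlib.Data.Finset.Max
import Mathlib.Data.Fin.VecNotation
import Mathlib.Tactic.FinCases
import Mathlib.Tactic.Linarith
import Mathlib.Tactic.Ring
import HarnessLib

/-!
# Re-basing a rank-2 chart on a pair of MAXIMAL AREA: every finite spanning set `U ⊂ ℤ²` is carried by an injective additive map
# `A : ℤ² → ℤ²` into the square `[−N, N]²` with `A u = (N, 0)`, `A v = (0, N)` for two of its elements (`N = |det(u, v)|`)

builds on p205010 (kernel theorem, internal audit signed; external expert review pending) — nothing in this file uses p205010; no probability.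
Lane `prim-bschramm`, seat `prim-bschramm-p4` gen 16 (PART C3 of `P4-GENERAL.md` §38: arbitrary generating sets).  Helper file
(`--supports stmt-CriticalPhenomena-4575 --as helper`).  Pure `ℤ²` arithmetic (the "Auerbach / maximal-minor" trick).

WHY.  A finitely generated group `Γ` with an additive `φ : Γ → ℤ²` and a finite generating set `S` gives the finite symmetric set
`U = ±φ(S) ⊂ ℤ²`.  The skeleton interfaces want a chart of sup-norm `≤ 1` on `S` with EXACT axis steps in `S`; for a tall or slanted `S` no such
chart exists at scale 1, but at scale `N` one always does: pick `u, v ∈ U` maximising `|det(u, v)|` and put `A x := sgn(det(u,v)) · (det(x, v), det(u, x))`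
(the signed adjugate of the matrix `[u v]`).  Then `A` is additive, `A u = N e₀`, `A v = N e₁` with `N = |det(u,v)|`, `‖A x‖_∞ ≤ N` for EVERY `x ∈ U`
(maximality: `|det(x,v)|, |det(u,x)| ≤ |det(u,v)|`), and `A` is injective when `det(u,v) ≠ 0` (Cramer: `det(u,v)·x = det(x,v)·u + det(u,x)·v`).
So `A ∘ φ` is an `N`-Lipschitz additive chart on `Cay(Γ; S)` with exact `N`-steps — the input of `PlanarSkeletonFrmScaled` (file
`PlanarSkeletonFrmScaledDefs`) — with the SAME kernel as `φ`.
* `MaxArea.det2`, bilinearity, `cramer`; `MaxArea.rebase u v` and `rebase_add/neg/sub/zero`, `rebase_left/right` (`= N eᵢ`),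
  `abs_rebase_le` (range `≤ N` under the maximality inequalities), `eq_zero_of_rebase_eq_zero` (injectivity), `exists_maxPair` (a maximising pair
  exists in every finite set containing an independent pair), `exists_rebase` (everything packaged).
[cite: BenjaminiSchramm1996, §2 (Cayley graphs)] [cite: MartineauTassion2017, §3.2 (good coordinates for abelian Cayley graphs)]
-/

namespace Summit.CriticalPhenomena.PercolationContinuityZ3.Theorems.Transplant

namespace MaxArea

open Literature.Probability.LatticeModels

/-! ## §1 The `2 × 2` determinant -/

/-- The determinant `det(u, v) = u₀ v₁ − u₁ v₀` of two vectors of `ℤ²`. [folklore] -/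
def det2 (u v : Site 2) : ℤ := u 0 * v 1 - u 1 * v 0

/-- `det(u, u) = 0`. [folklore] -/
@[simp] theorem det2_self (u : Site 2) : det2 u u = 0 := by unfold det2; ring

/-- Antisymmetry. [folklore] -/
theorem det2_swap (u v : Site 2) : det2 v u = -det2 u v := by unfold det2; ring

/-- Additivity in the first argument. [folklore] -/
theorem det2_add_left (u u' v : Site 2) : det2 (u + u') v = det2 u v + det2 u' v := by
  unfold det2; simp only [Pi.add_apply]; ring

/-- Additivity in the second argument. [folklore] -/
theorem det2_add_right (u v v' : Site 2) : det2 u (v + v') = det2 u v + det2 u v' := by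
  unfold det2; simp only [Pi.add_apply]; ring

/-- Negation in the first argument. [folklore] -/
theorem det2_neg_left (u v : Site 2) : det2 (-u) v = -det2 u v := by
  unfold det2; simp only [Pi.neg_apply]; ring

/-- Negation in the second argument. [folklore] -/
theorem det2_neg_right (u v : Site 2) : det2 u (-v) = -det2 u v := by
  unfold det2; simp only [Pi.neg_apply]; ring

/-- `det(0, v) = 0`. [folklore] -/
@[simp] theorem det2_zero_left (v : Site 2) : det2 0 v = 0 := by unfold det2; simp

/-- `det(u, 0) = 0`. [folklore] -/
@[simp] theorem det2_zero_right (u : Site 2) : det2 u 0 = 0 := by unfold det2; simp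

/-- **Cramer's identity in `ℤ²`**: `det(u,v)·x = det(x,v)·u + det(u,x)·v`, coordinatewise. [folklore] -/
theorem cramer (u v x : Site 2) (i : Fin 2) : det2 u v * x i = det2 x v * u i + det2 u x * v i := by
  fin_cases i <;> simp [det2] <;> ring

/-! ## §2 The re-basing map of a pair -/

/-- **The re-basing map** of the pair `(u, v)`: `x ↦ sgn(det(u,v)) · (det(x, v), det(u, x))` (the signed adjugate of `[u v]`). [folklore] -/
def rebase (u v : Site 2) (x : Site 2) : Site 2 := fun i => Int.sign (det2 u v) * (if i = 0 then det2 x v else det2 u x)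

/-- Coordinate `0` of the re-based vector. [folklore] -/
@[simp] theorem rebase_apply_zero (u v x : Site 2) : rebase u v x 0 = Int.sign (det2 u v) * det2 x v := by
  simp [rebase]

/-- Coordinate `1` of the re-based vector. [folklore] -/
@[simp] theorem rebase_apply_one (u v x : Site 2) : rebase u v x 1 = Int.sign (det2 u v) * det2 u x := by
  simp [rebase]

/-- The re-basing map is additive. [folklore] -/
theorem rebase_add (u v x y : Site 2) : rebase u v (x + y) = rebase u v x + rebase u v y := by
  funext i
  fin_cases i
  · simp [det2_add_left]; ring
  · simp [det2_add_right]; ring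

/-- The re-basing map sends `0` to `0`. [folklore] -/
@[simp] theorem rebase_zero (u v : Site 2) : rebase u v 0 = 0 := by
  funext i; fin_cases i <;> simp

/-- The re-basing map commutes with negation. [folklore] -/
theorem rebase_neg (u v x : Site 2) : rebase u v (-x) = -rebase u v x := by
  funext i
  fin_cases i
  · simp [det2_neg_left]
  · simp [det2_neg_right]

/-- The re-basing map commutes with subtraction. [folklore] -/
theorem rebase_sub (u v x y : Site 2) : rebase u v (x - y) = rebase u v x - rebase u v y := by
  rw [sub_eq_add_neg, rebase_add, rebase_neg, ← sub_eq_add_neg]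

/-- `|sgn(a) · b| ≤ |b|`. [folklore] -/
theorem abs_sign_mul_le (a b : ℤ) : |Int.sign a * b| ≤ |b| := by
  rcases lt_trichotomy a 0 with h | rfl | h
  · rw [Int.sign_eq_neg_one_of_neg h, neg_one_mul, abs_neg]
  · simp
  · rw [Int.sign_eq_one_of_pos h, one_mul]

/-- **`A u = N e₀`** with `N = |det(u, v)|`. [folklore] -/
theorem rebase_left (u v : Site 2) : rebase u v u = Pi.single 0 |det2 u v| := by
  funext i
  fin_cases i
  · simp
  · simp

/-- **`A v = N e₁`** with `N = |det(u, v)|`. [folklore] -/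
theorem rebase_right (u v : Site 2) : rebase u v v = Pi.single 1 |det2 u v| := by
  funext i
  fin_cases i
  · simp
  · simp

/-- **Range `≤ N` under the maximality inequalities**: if `|det(x,v)| ≤ |det(u,v)|` and `|det(u,x)| ≤ |det(u,v)|` then `‖A x‖_∞ ≤ |det(u,v)|`.
[folklore] -/
theorem abs_rebase_le {u v x : Site 2} (h₀ : |det2 x v| ≤ |det2 u v|) (h₁ : |det2 u x| ≤ |det2 u v|) (i : Fin 2) :
    |rebase u v x i| ≤ |det2 u v| := by
  fin_cases i
  · exact (abs_sign_mul_le _ _).trans (by simpa using h₀)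
  · exact (abs_sign_mul_le _ _).trans (by simpa using h₁)

/-- **Injectivity**: for an independent pair (`det(u,v) ≠ 0`), `A x = 0` forces `x = 0` (Cramer). [folklore] -/
theorem eq_zero_of_rebase_eq_zero {u v x : Site 2} (hD : det2 u v ≠ 0) (h : rebase u v x = 0) : x = 0 := by
  have hs : Int.sign (det2 u v) ≠ 0 := fun h0 => hD (Int.sign_eq_zero_iff_zero.1 h0)
  have h0 : det2 x v = 0 := by
    have := congrFun h 0
    rw [rebase_apply_zero, Pi.zero_apply, mul_eq_zero] at this
    exact this.resolve_left hs
  have h1 : det2 u x = 0 := by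
    have := congrFun h 1
    rw [rebase_apply_one, Pi.zero_apply, mul_eq_zero] at this
    exact this.resolve_left hs
  funext i
  have hc := cramer u v x i
  rw [h0, h1, zero_mul, zero_mul, add_zero, mul_eq_zero] at hc
  exact hc.resolve_left hD

/-- Injectivity as a function: `A x = A y → x = y`. [folklore] -/
theorem rebase_injective {u v : Site 2} (hD : det2 u v ≠ 0) : Function.Injective (rebase u v) := by
  intro x y h
  have h' : rebase u v (x - y) = 0 := by rw [rebase_sub, h, sub_self]
  exact sub_eq_zero.1 (eq_zero_of_rebase_eq_zero hD h')

/-! ## §3 A pair of maximal area exists -/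

/-- **A maximising pair**: a finite set containing an independent pair contains a pair `(u, v)` with `det(u,v) ≠ 0` maximising `|det|` over all
pairs of the set. [folklore] -/
theorem exists_maxPair (U : Finset (Site 2)) (h : ∃ u ∈ U, ∃ v ∈ U, det2 u v ≠ 0) :
    ∃ u ∈ U, ∃ v ∈ U, det2 u v ≠ 0 ∧ ∀ x ∈ U, ∀ y ∈ U, |det2 x y| ≤ |det2 u v| := by
  obtain ⟨u₀, hu₀, v₀, hv₀, hne⟩ := h
  have hne' : (U ×ˢ U).Nonempty := ⟨(u₀, v₀), Finset.mk_mem_product hu₀ hv₀⟩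
  obtain ⟨⟨u, v⟩, huv, hmax⟩ := Finset.exists_max_image (U ×ˢ U) (fun q => |det2 q.1 q.2|) hne'
  rw [Finset.mem_product] at huv
  refine ⟨u, huv.1, v, huv.2, ?_, fun x hx y hy => hmax (x, y) (Finset.mk_mem_product hx hy)⟩
  intro h0
  have h1 := hmax (u₀, v₀) (Finset.mk_mem_product hu₀ hv₀)
  simp only [h0, abs_zero] at h1
  exact hne (abs_eq_zero.1 (le_antisymm h1 (abs_nonneg _)))

/-- **THE RE-BASING LEMMA (packaged)**: a finite `U ⊂ ℤ²` containing an independent pair admits `u, v ∈ U` with `det(u,v) ≠ 0` such that, with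
`N = |det(u,v)|` and `A = rebase u v`: `A u = N e₀`, `A v = N e₁`, and `‖A x‖_∞ ≤ N` for every `x ∈ U` (additivity and injectivity of `A` are
`rebase_add` / `rebase_injective`). [folklore] -/
theorem exists_rebase (U : Finset (Site 2)) (h : ∃ u ∈ U, ∃ v ∈ U, det2 u v ≠ 0) :
    ∃ u ∈ U, ∃ v ∈ U, det2 u v ≠ 0 ∧ rebase u v u = Pi.single 0 |det2 u v| ∧ rebase u v v = Pi.single 1 |det2 u v| ∧
      ∀ x ∈ U, ∀ i : Fin 2, |rebase u v x i| ≤ |det2 u v| := by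
  obtain ⟨u, hu, v, hv, hD, hmax⟩ := exists_maxPair U h
  exact ⟨u, hu, v, hv, hD, rebase_left u v, rebase_right u v, fun x hx i => abs_rebase_le (hmax x hx v hv) (hmax u hu x hx) i⟩

end MaxArea

end Summit.CriticalPhenomena.PercolationContinuityZ3.Theorems.Transplant
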